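import Summits.AtomisticToContinuum.FouriersLaw.Theorems.HoelderEscapeProfileAbelSpreadCeilingCanonicalTwin
import Summits.AtomisticToContinuum.FouriersLaw.Theorems.HoelderEscapeProfileFibreCalculusStubTwiceIntegratedContinuity
import HarnessLib

/-!
# Stub `stub_perSiteHelfand` of line `regularity_collapse`, crux `HoelderEscapeProfile.AbelSpreadCeiling`
(item stmt-AtomisticToContinuum-16010; `--supports` file, closes nothing; line lead, 2026-08-17, cycle 1)

WHAT. Registered stub 4 of the crux's skeleton (`Cruxes/AbelSpreadCeiling/Lines/regularity_collapse.lean`): the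
PER-SITE, TWICE-INTEGRATED LOCAL CONSERVATION LAW of the split-bond energy density. For the pinned anharmonic
chain `pinnedChain ω₂ lam β γ` (`ω₂, lam, β > 0`), the shift- and momentum-reversal-invariant DLR state `μ` at
`T > 0` and ANY `μ`-preserving dynamics `D`, with `h_x = energyDensityZ`, `j_x = bondCurrentZ`,
`S(x,t) = Cov_μ(h_0, h_x ∘ φ_t)` and `G(x,u) = ∫ j_0 (j_x ∘ φ_u) dμ`:
`S(x,t) − S(x,0) = ∫_{(0,t]} (t − u) (G(x+1,u) − 2G(x,u) + G(x−1,u)) du` for every site `x` and `t > 0`.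

HOW (everything is in the tree). By the landed canonical twin (`stub_canonicalTwin`, sibling file
`…AbelSpreadCeilingCanonicalTwin`) there is a dynamics `D'` with carrier `bmGood`, measurable flow maps, identity
off `bmGood` and `D'.flow t =ᵐ[μ] D.flow t` at every time; hence `S` and `G` are unchanged when `D` is replaced by
`D'` (`integral_congr_ae`). For such a canonical `D'` the identity is the landed
`FibreCalculusSketch.stub_twiceIntegratedContinuity` (`Theorems/HoelderEscapeProfileFibreCalculusStubTwiceIntegratedContinuity.lean`:
pathwise `ḣ_x = j_{x−1} − j_x` on the carrier + FTC, Fubini on `[0,t] × Ω`, stationarity with the everywhere group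
law, shift covariance of the current pair correlations, momentum reversal `Cov(h_0, j_y) = 0`, and
`∫₀ᵗ∫₀ˢ F = ∫₀ᵗ (t−u)F(u) du`).
-/

noncomputable section

namespace Summit.AtomisticToContinuum.FouriersLaw.Theorems.AbelSpreadCeiling.RegularityCollapse

open MeasureTheory Filter Set Function
open scoped Topology BigOperators
open Literature.MathematicalPhysics.KineticTheory.HeatConduction

/-- **Stub `stub_perSiteHelfand` (registered signature, verbatim).** The per-site, twice-integrated local
conservation law of the split-bond energy density of the pinned anharmonic chain in its shift- and
reversal-invariant DLR state at `T > 0`, along ANY `μ`-preserving dynamics: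
`S(x,t) − S(x,0) = ∫_{(0,t]} (t − u) (G(x+1,u) − 2G(x,u) + G(x−1,u)) du` (`t > 0`), transferred from the canonical
Buttà–Marchioro twin along the a.e. equality of the flows.
[cite: Helfand1960, §II] [cite: BonettoLebowitzReyBellet2000, §6.3] -/
theorem stub_perSiteHelfand :
    ∀ ω₂ lam β γ : ℝ, 0 < ω₂ → 0 < lam → 0 < β → ∀ T : ℝ, 0 < T → ∀ μ : MeasureTheory.Measure ChainConfig, (pinnedChain ω₂ lam β γ).IsChainGibbsMeasure T μ → IsShiftInvariant μ → μ.map (fun σ : ChainConfig => fun x : ℤ => ((σ x).1, -(σ x).2)) = μ → ∀ D : InfiniteChainDynamics (pinnedChain ω₂ lam β γ), D.PreservesMeasure μ → (∀ t : ℝ, ∀ᵐ σ ∂μ, D.flow t (shift σ) = shift (D.flow t σ)) → ∀ h : ChainConfig → ℤ → ℝ, h = (fun (σ : ChainConfig) (x : ℤ) => (σ x).2 ^ 2 / 2 + (pinnedChain ω₂ lam β γ).U (σ x).1 + ((pinnedChain ω₂ lam β γ).V ((σ (x + 1)).1 - (σ x).1) + (pinnedChain ω₂ lam β γ).V ((σ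 x).1 - (σ (x - 1)).1)) / 2) → ∀ S : ℤ → ℝ → ℝ, S = (fun (x : ℤ) (t : ℝ) => ∫ σ, (h σ 0 - ∫ σ', h σ' 0 ∂μ) * (h (D.flow t σ) x - ∫ σ', h σ' 0 ∂μ) ∂μ) → ∀ G : ℤ → ℝ → ℝ, G = (fun (x : ℤ) (t : ℝ) => ∫ σ, (pinnedChain ω₂ lam β γ).bondCurrentZ σ 0 * (pinnedChain ω₂ lam β γ).bondCurrentZ (D.flow t σ) x ∂μ) → ∀ x : ℤ, ∀ t : ℝ, 0 < t → S x t - S x 0 = ∫ u in Set.Ioc (0:ℝ) t, (t - u) * (G (x + 1) u - 2 * G x u + G (x - 1) u) := by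
  intro ω₂ lam β γ hω hl hβ T hT μ hG hSI hR D hP _hcomm h hh S hS G hGdef x t ht
  -- the canonical twin: carrier `bmGood`, measurable flow, identity off `bmGood`, same flow a.e. at every time
  obtain ⟨D', hcar, hmeas, hid, -, hae, -, -⟩ := stub_canonicalTwin ω₂ lam β γ hω hl hβ T hT μ hG hSI hR D hP
  -- `S` and `G` are the objects of the twin
  have hS' : S = fun (x : ℤ) (t : ℝ) =>
      ∫ σ, (h σ 0 - ∫ σ', h σ' 0 ∂μ) * (h (D'.flow t σ) x - ∫ σ', h σ' 0 ∂μ) ∂μ := by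
    subst hS
    funext y s
    refine integral_congr_ae ?_
    filter_upwards [hae s] with σ hσ
    rw [hσ]
  have hG' : G = fun (x : ℤ) (t : ℝ) => ∫ σ, (pinnedChain ω₂ lam β γ).bondCurrentZ σ 0 *
      (pinnedChain ω₂ lam β γ).bondCurrentZ (D'.flow t σ) x ∂μ := by
    subst hGdef
    funext y s
    refine integral_congr_ae ?_
    filter_upwards [hae s] with σ hσ
    rw [hσ]
  -- the twice-integrated conservation law along the canonical twin
  exact Summit.AtomisticToContinuum.FouriersLaw.Theorems.FibreCalculusSketch.stub_twiceIntegratedContinuity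
    ω₂ lam β γ hω hl hβ T hT μ hG hSI hR D' hcar hmeas hid h hh S hS' G hG' x t ht.le

end Summit.AtomisticToContinuum.FouriersLaw.Theorems.AbelSpreadCeiling.RegularityCollapse

end
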